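import Summits.RiemannHypothesis.RiemannHypothesis.Theorems.WeilGroundStateArchimedeanWindowSimpleEvenTrial3
import Summits.RiemannHypothesis.RiemannHypothesis.Theorems.WeilWindowFlowWindowLipschitzStubFormDomainPos
import Literature.Analysis.SpecialFunctions.EulerMascheroniBounds
import Literature.NumberTheory.LFunctions.NicolasMertensRH
import HarnessLib

/-!
# `ArchimedeanWindowSimpleEven` — the trial function, IV: `ε((log 2)/2) ≤ 3/200`

The killing constant `M_{(log 2)/2} = 2∫₀^∞ (e^{t/2} − 1)/(2 sinh t) + log 4π + γ ≥ 5.367`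
(`64` terms of `Σ (1/(2k+1/2) − 1/(2k+1))` below the integral, the tree's `log π > 1.1436`,
`γ > 0.57721558` and Mathlib's `log 2`), and the UPPER bound for the bottom of Weil's form on the
archimedean window, `weilGroundEnergy ((log 2)/2) ≤ 3/200`, from the form-domain Rayleigh quotient
(`…WeilWindowFlowWindowLipschitz.stub_formDomainPos`, item WindowLipschitz of route WeilWindowFlow:
`C_c^∞` is dense from above in the form domain) of the bump `h`: `(M + ε)·16/45 ≤ P(h) + 𝓔(h)`.

Route `RiemannHypothesis/WeilGroundState`, item `ArchimedeanWindowSimpleEven` (stmt-RiemannHypothesis-1529).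
See `WeilGroundStateArchimedeanWindowSimpleEvenGapDefs.lean` for the certificate format, the data and the
overall plan (LOWER bounds by the gap certificate `weilGapCert`, UPPER bound `ε((log 2)/2) ≤ 3/200` by the
trial function `trialFun`).
-/

namespace Summit.RiemannHypothesis.RiemannHypothesis.Theorems.WeilGroundState

open Literature.NumberTheory.LFunctions

/-! ## The killing constant and the upper bound `ε((log 2)/2) ≤ 3/200` -/

section Upper

open Real Finset MeasureTheory Set Filter
open scoped BigOperators

/-- The killing density dominates the partial sums of its geometric expansion: for `t > 0`,
`Σ_{k<K} (e^{-(2k+1/2)t} − e^{-(2k+1)t}) ≤ (e^{t/2} − 1)/(2 sinh t)`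
(`= (e^{-t/2} − e^{-t})/(1 − e^{-2t})`). [folklore] -/
theorem partial_sum_le_weilKillingDensity {t : ℝ} (ht : 0 < t) (K : ℕ) :
    ∑ k ∈ Finset.range K, (Real.exp (-(2 * (k : ℝ) + 1 / 2) * t) - Real.exp (-(2 * (k : ℝ) + 1) * t)) ≤
      (Real.exp (t / 2) - 1) / (2 * Real.sinh t) := by
  set q : ℝ := Real.exp (-(2 * t)) with hq
  have hq0 : 0 < q := Real.exp_pos _
  have hq1 : q < 1 := Real.exp_lt_one_iff.2 (by linarith)
  have h1q : 0 < 1 - q := by linarith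
  have h1 : 2 * Real.sinh t = (1 - q) * Real.exp t := by
    rw [hq, Real.sinh_eq, sub_mul, ← Real.exp_add]; ring_nf
  have h2 : Real.exp (t / 2) - 1 = (Real.exp (-(t / 2)) - Real.exp (-t)) * Real.exp t := by
    rw [sub_mul, ← Real.exp_add, ← Real.exp_add, neg_add_cancel, Real.exp_zero]; ring_nf
  rw [h1, h2, mul_div_mul_right _ _ (Real.exp_pos t).ne']
  have hA : 0 ≤ Real.exp (-(t / 2)) - Real.exp (-t) :=
    sub_nonneg.2 (Real.exp_le_exp.2 (by linarith))
  -- Σ q^k ≤ 1/(1 − q)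
  have hgeom : ∑ k ∈ Finset.range K, q ^ k ≤ (1 - q)⁻¹ := by
    have h := geom_sum_mul_neg q K
    rw [← one_div, le_div_iff₀ h1q, h]
    linarith [pow_nonneg hq0.le K]
  have hterm : ∀ k ∈ Finset.range K,
      Real.exp (-(2 * (k : ℝ) + 1 / 2) * t) - Real.exp (-(2 * (k : ℝ) + 1) * t) =
        (Real.exp (-(t / 2)) - Real.exp (-t)) * q ^ k := by
    intro k _
    rw [hq, ← Real.exp_nat_mul, sub_mul, ← Real.exp_add, ← Real.exp_add]
    congr 2 <;> ring
  rw [Finset.sum_congr rfl hterm, ← Finset.mul_sum, div_eq_mul_inv]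
  exact mul_le_mul_of_nonneg_left hgeom hA

/-- **The killing integral**: `∫₀^∞ (e^{t/2} − 1)/(2 sinh t) dt ≥ 1.13`
(`= π/4 + (log 2)/2 = 1.1319…`; `64` terms of the series `Σ (1/(2k+1/2) − 1/(2k+1))`). [folklore] -/
theorem integral_weilKillingDensity_ge :
    (1.13 : ℝ) ≤ ∫ t in Ioi (0 : ℝ), (Real.exp (t / 2) - 1) / (2 * Real.sinh t) := by
  set F : ℝ → ℝ := fun t ↦ ∑ k ∈ Finset.range 64,
    (Real.exp (-(2 * (k : ℝ) + 1 / 2) * t) - Real.exp (-(2 * (k : ℝ) + 1) * t)) with hF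
  have ha : ∀ k : ℕ, -(2 * (k : ℝ) + 1 / 2) < 0 := fun k ↦ by
    have : (0 : ℝ) ≤ k := Nat.cast_nonneg k; linarith
  have hb : ∀ k : ℕ, -(2 * (k : ℝ) + 1) < 0 := fun k ↦ by
    have : (0 : ℝ) ≤ k := Nat.cast_nonneg k; linarith
  have hik : ∀ k : ℕ, IntegrableOn (fun t ↦ Real.exp (-(2 * (k : ℝ) + 1 / 2) * t) -
      Real.exp (-(2 * (k : ℝ) + 1) * t)) (Ioi 0) :=
    fun k ↦ (integrableOn_exp_mul_Ioi (ha k) _).sub (integrableOn_exp_mul_Ioi (hb k) _)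
  have hFi : IntegrableOn F (Ioi 0) := by
    rw [hF]; exact integrable_finsetSum _ fun k _ ↦ hik k
  have hFint : ∫ t in Ioi (0 : ℝ), F t =
      ∑ k ∈ Finset.range 64, (1 / (2 * (k : ℝ) + 1 / 2) - 1 / (2 * (k : ℝ) + 1)) := by
    rw [hF]
    simp only
    rw [integral_finsetSum _ fun k _ ↦ hik k]
    refine Finset.sum_congr rfl fun k _ ↦ ?_
    rw [integral_sub (integrableOn_exp_mul_Ioi (ha k) _) (integrableOn_exp_mul_Ioi (hb k) _),
      integral_exp_mul_Ioi (ha k), integral_exp_mul_Ioi (hb k)]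
    simp only [mul_zero, Real.exp_zero]
    have h1 : (2 * (k : ℝ) + 1 / 2) ≠ 0 := by linarith [ha k]
    have h2 : (2 * (k : ℝ) + 1) ≠ 0 := by linarith [hb k]
    field_simp
  calc (1.13 : ℝ) ≤ ∑ k ∈ Finset.range 64, (1 / (2 * (k : ℝ) + 1 / 2) - 1 / (2 * (k : ℝ) + 1)) := by
        simp only [Finset.sum_range_succ, Finset.sum_range_zero]
        norm_num
    _ = ∫ t in Ioi (0 : ℝ), F t := hFint.symm
    _ ≤ ∫ t in Ioi (0 : ℝ), (Real.exp (t / 2) - 1) / (2 * Real.sinh t) :=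
        setIntegral_mono_on hFi integrableOn_weilKillingDensity measurableSet_Ioi fun t ht ↦
          partial_sum_le_weilKillingDensity ht 64

/-- **The killing constant of the archimedean window**: `M_{(log 2)/2} ≥ 5.367`
(`= π/2 + 3 log 2 + log π + γ = 5.37218…`). [folklore] -/
theorem weilMarkovConstant_log_two_half_ge : (5.367 : ℝ) ≤ weilMarkovConstant (Real.log 2 / 2) := by
  unfold weilMarkovConstant
  rw [Finset.sum_eq_zero fun n hn ↦ by
    rw [vonMangoldt_eq_zero_of_mem_weilPrimeIndex_log_two_half hn]; simp]
  have h1 := integral_weilKillingDensity_ge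
  have h2 : Real.log (4 * π) = 2 * Real.log 2 + Real.log π := by
    rw [Real.log_mul (by norm_num) Real.pi_pos.ne', show (4 : ℝ) = 2 ^ 2 by norm_num, Real.log_pow]
    push_cast; ring
  have h3 := log_pi_gt
  have h4 := Real.log_two_gt_d9
  have h5 := Literature.Analysis.SpecialFunctions.Real.eulerMascheroniConstant_gt_d8
  rw [h2]
  linarith

/-- **The upper bound for the bottom of the archimedean window: `ε((log 2)/2) ≤ 3/200`.**
The form-domain Rayleigh quotient of the parabolic bump `h = (1 − 9x²)⁺`
(`Summit…WeilWindowFlowWindowLipschitz.stub_formDomainPos`: `(M_a + ε(a))‖f‖₂² ≤ P(f) + 𝓔_a(f)` for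
every `L²` function vanishing off the window with finite archimedean energy) with the bounds
`‖h‖₂² = 16/45`, `P(h) ≤ 0.3973`, `𝓔(h) ≤ 0.4324 + (32/45)·1.5225`, `M ≥ 5.367`; numerically the
quotient is `≈ 4.9·10⁻³` against the true bottom `ε ≈ 1.33·10⁻³`. [folklore] -/
theorem weilGroundEnergy_log_two_half_le : weilGroundEnergy (Real.log 2 / 2) ≤ 3 / 200 := by
  obtain ⟨hint, hE⟩ := weilDirichletEnergy_trialFun_le
  have ha : 0 < Real.log 2 / 2 := by have := Real.log_pos one_lt_two; positivity
  have h := Summit.RiemannHypothesis.RiemannHypothesis.Theorems.WeilWindowFlowWindowLipschitz.stub_formDomainPos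
    (Real.log 2 / 2) ha trialFun memLp_trialFun
    (Eventually.of_forall fun x hx ↦ trialFun_eq_zero_of_not_mem_window hx) hint
  rw [integral_norm_sq_trialFun] at h
  have hP := weilPoleForm_trialFun_le
  have hM := weilMarkovConstant_log_two_half_ge
  nlinarith

end Upper

end Summit.RiemannHypothesis.RiemannHypothesis.Theorems.WeilGroundState
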